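import Summits.CriticalPhenomena.CardyFormulaZ2.Theses.CardyMagicRigidity
import Literature.Probability.Percolation.CardyFormulaConformalInvariance
import Literature.Probability.Percolation.BoxCrossingUpperBound
import Literature.Probability.Percolation.ZdNearCriticalWindow
import Literature.Probability.Percolation.HalfSpacePinnedPairs
import Literature.Probability.Percolation.SharpnessDCTProofs
import Literature.Probability.RandomPlanarGeometry.ConformalRectangleProofs
import Literature.Probability.Percolation.PlateCrossingEvents
import Literature.Probability.Percolation.LatticeTraceBlocking
import Literature.Topology.PlaneTopology.PlusCrossing
import Literature.Probability.Percolation.FullPlaneCNL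
import Literature.Probability.Percolation.LoopRepresentation
import Literature.Probability.Percolation.InterfaceLoopPolygon
import Literature.Probability.Percolation.InterfaceStretches
import Literature.Probability.Percolation.TwoArmScalingLimitFromLoops
import Literature.Probability.RandomPlanarGeometry.LoopConfigurations
import Literature.Probability.RandomPlanarGeometry.LoopDistanceParametrisation

/-!
# Stub C-T2b of line `oracle-sandwich` (crux `LoopsToCrossings`, stmt-CriticalPhenomena-4837)

**A horizontal medial loop arc, `η`-close to the honeycomb loops, blocks every monochromatic
vertical `𝕋` plate crossing** (`stub_triBlockedByCloseArc`, deterministic).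

Proof.  Fix the chart `Φ` and the room `c > 0`; let `ν := c / 4` and let `ρ ∈ (0, 1]` be a chart
room for `ν` on the compact `plateBox 2 2` (`PlaneTopology.exists_chart_room`: a point within `ρ` of `Φ z`,
`z ∈ plateBox 2 2`, pulls back to within `ν` of `z`).  Take `η₀ := ρ / 2` and `δ₀ := ρ`.
Given the data, the unbased loop `u` of `loopCurve δ 0 γ` is a member of the `ℤ²` loop
configuration (`mem_bondLoopConfig_iff`) with trace in `B(0, 1/η)`, so `IsClose η` provides a
honeycomb interface loop `w` of `ω'` whose unbased loop is at unoriented distance `≤ η < 2η` from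
`u` (`mem_siteLoopConfig_iff`).  By `CurveClass.exists_continuum_near_arc_of_udist_lt` the arc
`α([s, t])` is shadowed by a compact connected `H ⊆ range (siteLoopCurve δ w) = polyTrace δ w`,
matched pointwise within `2η ≤ ρ`; the chart room then puts `Φ⁻¹(H)` in the band
`|im| ≤ y + c/2 + ν ≤ y + c` and makes it reach `re ≤ -(xin - c/2) + ν = -((xin - c) + ν)` and
`(xin - c) + ν ≤ re`.  The blocking lemma
`IsSiteInterfaceLoop.not_mem_triMonoPlateV_of_chart_continuum` (a vertical plate walk of
`V(xin - c, y + c, yout')` would meet `H`, but open–open and closed–closed centre segments miss the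
interface polygon) concludes.  Sources: Camia–Newman, CMP 268 (2006), §5; DKKMO
arXiv:2012.11672v2 §5.2.

Self-contained variant: the private helpers below are verbatim the theorems of the landed Literature
files `Literature/Probability/RandomPlanarGeometry/CloseLoopArcs.lean` (p80913) and
`Literature/Probability/Percolation/TriPlateBlocking.lean` (p80559), repeated privately here only
because those modules were not yet built on the Lean farm when this stub was landed.
-/

noncomputable section

namespace Summit.CriticalPhenomena.CardyFormulaZ2.Cruxes.LoopsToCrossings.OracleSandwich

open Summit.CriticalPhenomena.CardyFormulaZ2.Theses.CardyMagicRigidity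
open Literature.Probability.RandomPlanarGeometry hiding cardyFunction
open Literature.Probability.Percolation hiding cardyFunction
open Literature.Probability.LatticeModels
open Literature.Topology.PlaneTopology
open Filter Topology Set MeasureTheory Metric Complex unitInterval

/-! ### Private helpers (= `CloseLoopArcs.lean`, `TriPlateBlocking.lean`) -/

section Helpers

variable {E : Type*} [MetricSpace E]

/-- **A parameter arc of a loop is shadowed by a sub-continuum of any `ε`-close loop.**  If the
unbased loops of the based loops `α`, `β` are at unoriented distance `d < ε`, then for every
parameter interval `[s, t]` there is a compact connected `H ⊆ range β` such that every `α u`,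
`u ∈ [s, t]`, is within `ε` of a point of `H`, and every point of `H` is within `ε` of some `α u`,
`u ∈ [s, t]` (`H` is the image of `[s, t]` under the `ε`-close parametrisation of `β` given by
`Curve.exists_orientation_shift_reparam_forall_dist_lt`). [cite: arXiv201211672v2, §1.2 eq. (1)] -/
private theorem exists_continuum_near_arc_curve {α β : Curve E} (hα : α.IsLoop)
    (hβ : β.IsLoop) {ε : ℝ}
    (h : UnbasedLoop.udist (UnbasedLoop.mk (BasedLoop.mk (CurveClass.mk α) (CurveClass.isLoop_mk.2 hα)))
      (UnbasedLoop.mk (BasedLoop.mk (CurveClass.mk β) (CurveClass.isLoop_mk.2 hβ))) < ε) (s t : I) :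
    ∃ H ⊆ β.range, IsCompact H ∧ IsPreconnected H ∧
      (∀ u ∈ Icc s t, ∃ p ∈ H, dist (α u) p < ε) ∧ (∀ p ∈ H, ∃ u ∈ Icc s t, dist (α u) p < ε) := by
  obtain ⟨β', hβ', -, b, φ, hclose⟩ := Curve.exists_orientation_shift_reparam_forall_dist_lt hα hβ h
  refine ⟨((β'.shift b).reparam φ) '' Icc s t, ?_, isCompact_Icc.image (Curve.continuous _),
    isPreconnected_Icc.image _ (Curve.continuous _).continuousOn, ?_, ?_⟩
  · have hr : ((β'.shift b).reparam φ).range = β.range := by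
      rw [Curve.range_reparam, Curve.range_shift]
      rcases hβ' with rfl | rfl
      · rfl
      · exact Curve.range_reverse β
    rw [← hr]
    rintro _ ⟨u, -, rfl⟩
    exact ⟨u, rfl⟩
  · exact fun u hu ↦ ⟨_, mem_image_of_mem _ hu, hclose u⟩
  · rintro _ ⟨u, hu, rfl⟩
    exact ⟨u, hu, hclose u⟩

/-- **A parameter arc of a loop class is shadowed by a sub-continuum of the trace of any
`ε`-close loop class**: the same for loop classes `c`, `c'` at unoriented unbased distance `< ε`
and an arbitrary based representative `α` of `c` (`CurveClass.mk α = c`); the piece lies in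
`c'.range`. [cite: arXiv201211672v2, §1.2 eq. (1)] -/
private theorem exists_continuum_near_arc_class {c c' : CurveClass E} (hc : c.IsLoop)
    (hc' : c'.IsLoop) {ε : ℝ}
    (h : UnbasedLoop.udist (UnbasedLoop.mk (BasedLoop.mk c hc)) (UnbasedLoop.mk (BasedLoop.mk c' hc')) < ε)
    {α : Curve E} (hα : CurveClass.mk α = c) (s t : I) :
    ∃ H ⊆ c'.range, IsCompact H ∧ IsPreconnected H ∧
      (∀ u ∈ Icc s t, ∃ p ∈ H, dist (α u) p < ε) ∧ (∀ p ∈ H, ∃ u ∈ Icc s t, dist (α u) p < ε) := by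
  subst hα
  obtain ⟨β, rfl⟩ := CurveClass.surjective_mk c'
  rw [CurveClass.range_mk]
  exact exists_continuum_near_arc_curve (CurveClass.isLoop_mk.1 hc) (CurveClass.isLoop_mk.1 hc') h s t

end Helpers

/-- **An edge of `δ𝕋` between two closed sites (or a closed lattice point) misses the trace**: a
crossed edge has an open endpoint (Camia–Newman 2006, §4: the interface runs between an open and
a closed hexagon). [cite: CamiaNewman2006, §4] -/
private theorem segment_disjoint_polyTrace_of_not_mem' {ω : SiteConfig (Site 2)} {f₀ : HexVertex}
    {w : hexGraph.Walk f₀ f₀} (hw : IsSiteInterfaceLoop ω w) {δ : ℝ} (hδ : 0 < δ) {a b : Site 2}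
    (hab : a = b ∨ triGraph.Adj a b) (ha : a ∉ ω) (hb : b ∉ ω) :
    Disjoint (segment ℝ (triMeshPoint δ a) (triMeshPoint δ b)) (polyTrace δ w) := by
  refine disjoint_left.2 fun q hq1 hq ↦ ?_
  obtain ⟨i, hi, hq2⟩ := mem_polyTrace_iff.1 hq
  rcases hw.eq_lv_rv_of_inter hδ hab hi hq1 hq2 with ⟨-, h2⟩ | ⟨h1, -⟩
  · exact hb (h2 ▸ hw.lv_mem hi)
  · exact ha (h1 ▸ hw.lv_mem hi)

/-- Points at distance `≤ ν` have real and imaginary parts within `ν`. [folklore] -/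
private theorem abs_re_sub_le_and_abs_im_sub_le_of_dist_le' {p z : ℂ} {ν : ℝ} (h : dist p z ≤ ν) :
    |p.re - z.re| ≤ ν ∧ |p.im - z.im| ≤ ν := by
  rw [dist_eq_norm] at h
  exact ⟨(sub_re p z ▸ abs_re_le_norm (p - z)).trans h, (sub_im p z ▸ abs_im_le_norm (p - z)).trans h⟩

/-- **Chart room for traces.**  Suppose `Φ⁻¹` moves every point within `ρ` of `Φ z`,
`z ∈ plateBox X Y`, to within `ν` of `z`, and `|δ| ≤ ρ`.  Then the trace of a `𝕋`-walk whose
sites are drawn (by `triMeshPoint δ`) in `Φ(plateBox x yout)`, `plateBox x yout ⊆ plateBox X Y`,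
pulls back into `plateBox (x + ν) (yout + ν)`: every trace point is within one mesh of a drawn
site. [folklore] -/
private theorem symm_mem_plateBox_of_mem_triWalkTrace' (Φ : ℂ ≃ₜ ℂ) {ν ρ δ x yout X Y : ℝ}
    (hroom : ∀ z ∈ plateBox X Y, ∀ p : ℂ, dist p (Φ z) ≤ ρ → dist (Φ.symm p) z ≤ ν)
    (hδ : |δ| ≤ ρ) (hsub : plateBox x yout ⊆ plateBox X Y) {u v : Site 2} {π : triGraph.Walk u v}
    (hπ : ∀ z ∈ π.support, triMeshPoint δ z ∈ Φ '' plateBox x yout) {p : ℂ}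
    (hp : p ∈ triWalkTrace δ π) : Φ.symm p ∈ plateBox (x + ν) (yout + ν) := by
  obtain ⟨s, hs, hdist⟩ := exists_dist_triMeshPoint_le_of_mem_triWalkTrace hp
  obtain ⟨z, hz, hzs⟩ := hπ s hs
  have hd : dist (Φ.symm p) z ≤ ν := hroom z (hsub hz) p (by rw [hzs]; exact hdist.trans hδ)
  obtain ⟨hre, him⟩ := abs_re_sub_le_and_abs_im_sub_le_of_dist_le' hd
  rw [abs_le] at hre him
  rw [plateBox, mem_reProdIm, mem_Icc, mem_Icc] at hz ⊢
  obtain ⟨⟨hz1, hz2⟩, hz3, hz4⟩ := hz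
  exact ⟨⟨by linarith [hre.1], by linarith [hre.2]⟩, by linarith [him.1], by linarith [him.2]⟩

/-- **A vertical plate walk on `δ𝕋` meets every chart-horizontal continuum of the band.**  With
chart room `(ν, ρ)` on `plateBox X Y ⊇ plateBox x yout` and `|δ| ≤ ρ`: a `𝕋`-walk with sites
drawn in `Φ(plateBox x yout)` from a site drawn in `Φ{im ≤ -yin}` to one drawn in `Φ{yin ≤ im}`
(`0 < yin`) meets every compact connected `H` whose pull-back `Φ⁻¹(H)` lies in the band
`-yin ≤ im ≤ yin` and reaches `{re ≤ -(x + ν)}` and `{x + ν ≤ re}` — the drawn trace pulls back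
into the strip `|re| ≤ x + ν` and joins the two zones, so the two continua are in plus position
(`inter_nonempty_of_plus_chart`; Bollobás–Riordan 2006, Ch. 7 Claim 19: a vertical and a
horizontal crossing meet). [cite: BollobasRiordan2006, Ch. 7 Claim 19 p. 192] -/
private theorem triWalkTrace_inter_nonempty_of_chart' (Φ : ℂ ≃ₜ ℂ) {ν ρ δ x yin yout X Y : ℝ}
    (hroom : ∀ z ∈ plateBox X Y, ∀ p : ℂ, dist p (Φ z) ≤ ρ → dist (Φ.symm p) z ≤ ν)
    (hδ : |δ| ≤ ρ) (hsub : plateBox x yout ⊆ plateBox X Y) (hx : 0 ≤ x + ν) (hyin : 0 < yin)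
    {u v : Site 2} (π : triGraph.Walk u v)
    (hπ : ∀ z ∈ π.support, triMeshPoint δ z ∈ Φ '' plateBox x yout)
    (hu : triMeshPoint δ u ∈ Φ '' {z : ℂ | z.im ≤ -yin})
    (hv : triMeshPoint δ v ∈ Φ '' {z : ℂ | yin ≤ z.im})
    {H : Set ℂ} (hH : IsCompact H) (hHc : IsPreconnected H)
    (hHband : ∀ p ∈ H, -yin ≤ (Φ.symm p).im ∧ (Φ.symm p).im ≤ yin)
    (hHa : ∃ p ∈ H, (Φ.symm p).re ≤ -(x + ν)) (hHb : ∃ p ∈ H, x + ν ≤ (Φ.symm p).re) :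
    (triWalkTrace δ π ∩ H).Nonempty := by
  obtain ⟨z₁, hz₁, h₁⟩ := hu
  obtain ⟨z₂, hz₂, h₂⟩ := hv
  simp only [mem_setOf_eq] at hz₁ hz₂
  have hne : u ≠ v := by
    rintro rfl
    have h12 : z₁ = z₂ := Φ.injective (h₁.trans h₂.symm)
    rw [h12] at hz₁
    linarith
  have hn : ¬ π.Nil := SimpleGraph.Walk.not_nil_of_ne hne
  refine inter_nonempty_of_plus_chart Φ (a := -(x + ν)) (b := x + ν) (c := -yin) (d := yin)
    (by linarith) (by linarith) (isCompact_triWalkTrace δ π) (isPreconnected_triWalkTrace δ π)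
    ?_ ?_ ?_ hH hHc hHband hHa hHb
  · intro p hp
    have h := symm_mem_plateBox_of_mem_triWalkTrace' Φ hroom hδ hsub hπ hp
    rw [plateBox, mem_reProdIm, mem_Icc] at h
    exact ⟨by linarith [h.1.1], h.1.2⟩
  · refine ⟨_, triMeshPoint_mem_triWalkTrace hn π.start_mem_support, ?_⟩
    rw [← h₁, Homeomorph.symm_apply_apply]
    exact hz₁
  · refine ⟨_, triMeshPoint_mem_triWalkTrace hn π.end_mem_support, ?_⟩
    rw [← h₂, Homeomorph.symm_apply_apply]
    exact hz₂

/-- **No vertical plate crossing across a chart-horizontal continuum off the `χ`-edges.**  In the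
situation of `triWalkTrace_inter_nonempty_of_chart`, if every drawn edge of `δ𝕋` between two
sites of `χ` misses `H`, then `χ ∉ triPlateV Φ δ x yin yout` (an open plate path would be such a
walk through sites of `χ`, and the common point lies on one of its edges).
[cite: BollobasRiordan2006, Ch. 7 Claim 19 p. 192] -/
private theorem not_mem_triPlateV_of_chart_continuum' (Φ : ℂ ≃ₜ ℂ) {ν ρ δ x yin yout X Y : ℝ}
    (hroom : ∀ z ∈ plateBox X Y, ∀ p : ℂ, dist p (Φ z) ≤ ρ → dist (Φ.symm p) z ≤ ν)
    (hδ : |δ| ≤ ρ) (hsub : plateBox x yout ⊆ plateBox X Y) (hx : 0 ≤ x + ν) (hyin : 0 < yin)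
    {H : Set ℂ} (hH : IsCompact H) (hHc : IsPreconnected H)
    (hHband : ∀ p ∈ H, -yin ≤ (Φ.symm p).im ∧ (Φ.symm p).im ≤ yin)
    (hHa : ∃ p ∈ H, (Φ.symm p).re ≤ -(x + ν)) (hHb : ∃ p ∈ H, x + ν ≤ (Φ.symm p).re)
    {χ : SiteConfig (Site 2)}
    (hdisj : ∀ a b : Site 2, triGraph.Adj a b → a ∈ χ → b ∈ χ →
      Disjoint (segment ℝ (triMeshPoint δ a) (triMeshPoint δ b)) H) :
    χ ∉ triPlateV Φ δ x yin yout := by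
  rintro ⟨u, hu, v, hv, hconn⟩
  obtain ⟨π, hπ⟩ := (mem_siteConnIn_iff_pathIn.1 hconn).exists_walk
  obtain ⟨p, hp, hpH⟩ := triWalkTrace_inter_nonempty_of_chart' Φ hroom hδ hsub hx hyin π
    (fun z hz ↦ (hπ z hz).1) hu hv hH hHc hHband hHa hHb
  obtain ⟨e, he, hpe⟩ := mem_triWalkTrace_iff.1 hp
  revert he hpe
  induction e using Sym2.ind with
  | h a b =>
    intro he hpe
    rw [triEdgeSeg_mk] at hpe
    exact Set.disjoint_left.1 (hdisj a b (π.adj_of_mem_edges he)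
      (hπ a (π.fst_mem_support_of_mem_edges he)).2 (hπ b (π.snd_mem_support_of_mem_edges he)).2)
      hpe hpH

/-- **An interface arc in horizontal position blocks every monochromatic vertical plate crossing.**
Let `w` be an interface loop of `ω` on `δ𝕋` (`0 < δ ≤ ρ`, chart room `(ν, ρ)` on
`plateBox X Y ⊇ plateBox x yout`) and `H ⊆ polyTrace δ w` a compact connected piece of its polygon
whose pull-back lies in the band `|im| ≤ yin` and reaches `{re ≤ -(x + ν)}` and `{x + ν ≤ re}`.
Then `ω ∉ triMonoPlateV Φ δ x yin yout`: an open (resp. closed) vertical plate path would meet `H`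
(`triWalkTrace_inter_nonempty_of_chart`), but open–open and closed–closed edges miss the interface
polygons (Camia–Newman 2006, §4–5). [cite: CamiaNewman2006, §5] -/
private theorem not_mem_triMonoPlateV_of_chart_continuum' {ω : SiteConfig (Site 2)}
    {f₀ : HexVertex} {w : hexGraph.Walk f₀ f₀} (hw : IsSiteInterfaceLoop ω w) (Φ : ℂ ≃ₜ ℂ)
    {ν ρ δ x yin yout X Y : ℝ}
    (hroom : ∀ z ∈ plateBox X Y, ∀ p : ℂ, dist p (Φ z) ≤ ρ → dist (Φ.symm p) z ≤ ν)
    (hδ0 : 0 < δ) (hδ : δ ≤ ρ) (hsub : plateBox x yout ⊆ plateBox X Y) (hx : 0 ≤ x + ν)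
    (hyin : 0 < yin) {H : Set ℂ} (hH : IsCompact H) (hHc : IsPreconnected H)
    (hHw : H ⊆ polyTrace δ w)
    (hHband : ∀ p ∈ H, -yin ≤ (Φ.symm p).im ∧ (Φ.symm p).im ≤ yin)
    (hHa : ∃ p ∈ H, (Φ.symm p).re ≤ -(x + ν)) (hHb : ∃ p ∈ H, x + ν ≤ (Φ.symm p).re) :
    ω ∉ triMonoPlateV Φ δ x yin yout := by
  have hδ' : |δ| ≤ ρ := by rwa [abs_of_pos hδ0]
  rintro (h | h)
  · exact not_mem_triPlateV_of_chart_continuum' Φ hroom hδ' hsub hx hyin hH hHc hHband hHa hHb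
      (fun a b hab ha hb ↦ (hw.segment_disjoint_polyTrace_of_mem hδ0 (Or.inr hab) ha hb).mono_right
        hHw) h
  · exact not_mem_triPlateV_of_chart_continuum' Φ hroom hδ' hsub hx hyin hH hHc hHband hHa hHb
      (fun a b hab ha hb ↦ (segment_disjoint_polyTrace_of_not_mem' hw hδ0 (Or.inr hab) ha hb).mono_right
        hHw) h

/-! ### The stub -/

/-- The image point `Φ z` of the arc determines its chart point: if `Φ z` lies in the image of a
set `S`, then `z ∈ S`. [folklore] -/
private theorem mem_of_apply_mem_image {Φ : ℂ ≃ₜ ℂ} {S : Set ℂ} {z : ℂ} (h : Φ z ∈ Φ '' S) : z ∈ S := by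
  obtain ⟨z', hz', he⟩ := h
  rwa [← Φ.injective he]

/-- `plateBox x y` is compact. [folklore] -/
private theorem isCompact_plateBox_stub (x y : ℝ) : IsCompact (plateBox x y) :=
  isCompact_Icc.reProdIm isCompact_Icc

/-- Coordinates of a point of `plateBox x y`. [folklore] -/
private theorem coords_of_mem_plateBox {x y : ℝ} {z : ℂ} (hz : z ∈ plateBox x y) :
    (-x ≤ z.re ∧ z.re ≤ x) ∧ (-y ≤ z.im ∧ z.im ≤ y) := by
  simpa only [plateBox, Complex.mem_reProdIm, mem_Icc] using hz

/-- **Stub C-T2b — a horizontal medial loop arc, `η`-close to the honeycomb loops, blocks every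
monochromatic vertical `𝕋` plate crossing** (deterministic).  `IsClose η` gives a honeycomb partner
loop at unoriented distance `≤ η` (the arc's loop has its trace in `B(0, 1/η)`);
`CurveClass.exists_continuum_near_arc_of_udist_lt` (built on
`Curve.exists_orientation_shift_reparam_forall_dist_lt`) shadows the parameter arc by a connected
piece of the partner's polygon `polyTrace`, pointwise `2η`-close, hence (chart room) inside the band
`|im| < y + c` and reaching `re ≤ -(xin - c) - c/4` and `xin - c + c/4 ≤ re`; an open (or closed)
vertical crossing of `V(xin - c, y + c, ·)` would meet it, but centre-to-centre segments of
equal-colour neighbours miss every interface polygon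
(`IsSiteInterfaceLoop.not_mem_triMonoPlateV_of_chart_continuum`).  (Camia–Newman, CMP 268 (2006),
§5; DKKMO arXiv:2012.11672v2 §5.2.) [cite: CamiaNewman2006, §5] -/
theorem stub_triBlockedByCloseArc :
    ∀ (Φ : ℂ ≃ₜ ℂ) (c : ℝ), 0 < c → ∃ η₀ : ℝ, 0 < η₀ ∧ ∀ η : ℝ, 0 < η → η ≤ η₀ →
      ∃ δ₀ : ℝ, 0 < δ₀ ∧ ∀ δ : ℝ, 0 < δ → δ ≤ δ₀ →
      ∀ (xin y : ℝ), 2 * c ≤ xin → xin ≤ 2 → c ≤ y → y + c ≤ 2 →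
      ∀ (ω : BondConfig (Site 2)) (ω' : SiteConfig (Site 2)),
        LoopConfig.IsClose η (bondLoopConfig δ 0 ω) (siteLoopConfig δ ω') →
        ∀ γ : List MedialVertex, IsInterfaceLoop ω γ → (loopCurve δ 0 γ).range ⊆ ball (0 : ℂ) (1 / η) →
          ∀ (α : Curve ℂ) (s t : unitInterval), CurveClass.mk α = loopCurve δ 0 γ → s ≤ t →
            (∀ u ∈ Icc s t, α u ∈ Φ '' plateBox xin (y + c / 2)) →
            (∃ u ∈ Icc s t, α u ∈ Φ '' {z : ℂ | z.re ≤ -(xin - c / 2)}) →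
            (∃ u ∈ Icc s t, α u ∈ Φ '' {z : ℂ | xin - c / 2 ≤ z.re}) →
            ∀ yout' : ℝ, yout' ≤ 2 → ω' ∉ triMonoPlateV Φ δ (xin - c) (y + c) yout' := by
  intro Φ c hc
  obtain ⟨ρ, hρ, hroom⟩ :=
    Literature.Topology.PlaneTopology.exists_chart_room Φ (isCompact_plateBox_stub 2 2) (ν := c / 4) (by positivity)
  refine ⟨ρ / 2, by positivity, fun η hη hηρ ↦ ⟨ρ, hρ, fun δ hδ hδρ ↦ ?_⟩⟩
  intro xin y hxin hxin2 hy hy2 ω ω' hC γ hγ hrange α s t hα _hst hband hleft hright yout' hyout'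
  -- the unbased loop of `γ` is a member of the `ℤ²` configuration, in the window
  have hu : UnbasedLoop.mk (BasedLoop.mk (loopCurve δ 0 γ) (isLoop_loopCurve δ 0 hγ.ne_nil)) ∈
      (bondLoopConfig δ 0 ω).F (loopType γ) :=
    mem_bondLoopConfig_iff.2 ⟨γ, hγ, rfl, rfl⟩
  obtain ⟨u', hu', hdist⟩ := (hC (loopType γ)).1 _ hu hrange
  obtain ⟨f, w, hw, -, rfl⟩ := mem_siteLoopConfig_iff.1 hu'
  -- a sub-continuum of the partner's polygon shadowing the arc, pointwise within `2η ≤ ρ`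
  have hdist' : UnbasedLoop.udist
      (UnbasedLoop.mk (BasedLoop.mk (loopCurve δ 0 γ) (isLoop_loopCurve δ 0 hγ.ne_nil)))
      (UnbasedLoop.mk (BasedLoop.mk (siteLoopCurve δ w) (isLoop_siteLoopCurve δ w))) < 2 * η := by
    linarith
  obtain ⟨H, hHsub, hH, hHc, hnear, hnear'⟩ :=
    exists_continuum_near_arc_class _ _ hdist' hα s t
  rw [range_siteLoopCurve hw.length_pos] at hHsub
  -- chart reading of the points of `H`
  have h2η : 2 * η ≤ ρ := by linarith
  have hsub2 : plateBox xin (y + c / 2) ⊆ plateBox 2 2 := plateBox_mono hxin2 (by linarith)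
  have key : ∀ u ∈ Icc s t, ∀ p : ℂ, dist (α u) p < 2 * η → ∃ z ∈ plateBox xin (y + c / 2),
      α u = Φ z ∧ |(Φ.symm p).re - z.re| ≤ c / 4 ∧ |(Φ.symm p).im - z.im| ≤ c / 4 := by
    intro u hu p hp
    obtain ⟨z, hz, hzu⟩ := hband u hu
    refine ⟨z, hz, hzu.symm, abs_re_sub_le_and_abs_im_sub_le_of_dist_le' (hroom z (hsub2 hz) p ?_)⟩
    rw [hzu, dist_comm]
    exact hp.le.trans h2η
  refine not_mem_triMonoPlateV_of_chart_continuum' hw Φ hroom hδ hδρ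
    (plateBox_mono (by linarith) hyout') (by linarith) (by linarith) hH hHc hHsub ?_ ?_ ?_
  · intro p hp
    obtain ⟨u, hu, hup⟩ := hnear' p hp
    obtain ⟨z, hz, -, -, him⟩ := key u hu p hup
    obtain ⟨-, hz1, hz2⟩ := coords_of_mem_plateBox hz
    obtain ⟨him1, him2⟩ := abs_le.1 him
    constructor <;> linarith
  · obtain ⟨u, hu, hul⟩ := hleft
    obtain ⟨p, hp, hup⟩ := hnear u hu
    obtain ⟨z, -, hzu, hre, -⟩ := key u hu p hup
    rw [hzu] at hul
    have hzl : z.re ≤ -(xin - c / 2) := mem_of_apply_mem_image hul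
    refine ⟨p, hp, ?_⟩
    obtain ⟨-, hre2⟩ := abs_le.1 hre
    linarith
  · obtain ⟨u, hu, hur⟩ := hright
    obtain ⟨p, hp, hup⟩ := hnear u hu
    obtain ⟨z, -, hzu, hre, -⟩ := key u hu p hup
    rw [hzu] at hur
    have hzr : xin - c / 2 ≤ z.re := mem_of_apply_mem_image hur
    refine ⟨p, hp, ?_⟩
    obtain ⟨hre1, -⟩ := abs_le.1 hre
    linarith

end Summit.CriticalPhenomena.CardyFormulaZ2.Cruxes.LoopsToCrossings.OracleSandwich

end
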